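import Literature.Analysis.FluidPDE.TsaiHeadPressureIdentity
import Literature.Analysis.FluidPDE.SobolevVanishingAtInfinity
import Literature.Analysis.FluidPDE.SteadyDSolutionPressureHessian
import HarnessLib

/-!
# The head pressure of a decaying steady Navier–Stokes solution stays below its limit at infinity
# (weak maximum principle for `½|u|² + p`; Chae–Weng 2016, Lemma 3.1; Wang 2025, §3.5.1)

Analysis/FluidPDE proofs file (theorems only: no definitions, no named facts), obligation O1b″ of
the «cylinder budget» lines of the steady Liouville items stmt-NavierStokesRegularity-0895 and
-0896 (director-ns #210). For a classical steady solution `(U, P)` of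
`−νΔU + (U·∇)U + ∇P = 0`, `div U = 0` on `ℝ³` (`IsLerayProfile ν 0 U P`, `ν > 0`, `U ∈ C^∞`)
with `U → 0` and `P → c` at infinity, the head pressure `Hd = ½|U|² + P` satisfies `Hd ≤ c`
everywhere: `Hd` is a subsolution, `νΔHd − U·∇Hd = ν|curl U|² ≥ 0` (the tree's
`IsLerayProfile.driftOp_headPressure_nonneg`, Tsai 1998 (1.7)), and the weak maximum principle on
large balls with `Hd → c` gives the claim (Chae–Weng 2016, Lemma 3.1 with (3.6)–(3.8): "`(u·∇)Φ − ΔΦ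
= −|curl u|² ≤ 0` … `Φ ≤ 0`"; Wang 2025 p. 50: "因为 `Q(x) = |u(x)|²/2 + p ≤ 0`"). The Lean proof
perturbs by the strict supersolution `ε·exp(k|y − x₁|²)`, `k > M²/(24ν²)` with `|U| ≤ M`
(`driftOp_gaussAt`), excludes an interior maximum on `B̄(x₁, R)` (`laplacian_nonpos_of_isLocalMax`),
and lets `ε → 0`, `R → ∞`.

* `IsLerayProfile.isSteadyNSSolution_zero` — the rate-`0` Leray profile system IS the steady system
  (bridge to `SteadyNSSolution.lean`);
* `headPressure_le_of_tendsto` — `½|U x|² + P x ≤ c` for all `x`;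
* `headMaximumPrinciple_of_uniformDecay` — the allaxes obligation `HeadMaximumPrinciple` VERBATIM
  (`∃ c, P → c ∧ ∀ x, P x + ‖U x‖²/2 ≤ c` under the ⟨0895⟩ hypotheses), conditional on the named
  fact `wang2025_thm21_DSolution_uniformDecay` (Galdi X.5.1) through
  `exists_tendsto_pressure_of_tendsto_zero`.

## References

* D. Chae, S. Weng, *Liouville type theorems for the steady axially symmetric Navier–Stokes and
  magnetohydrodynamic equations*, Discrete Contin. Dyn. Syst. 36 (2016) = arXiv:1512.03491, Lemma 3.1
  and (3.6)–(3.8). [ChaeWeng2016]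
* W. Wang, *稳态Navier–Stokes方程的Liouville定理* (2025), §3.5.1, p. 50. [Wang2025]
* T.-P. Tsai, ARMA 143 (1998), (1.7). [Tsai1998]
-/

noncomputable section

namespace Literature.Analysis.FluidPDE

open _root_.MeasureTheory _root_.Filter _root_.Set _root_.Metric
open scoped Topology RealInnerProductSpace

/-- **The rate-`0` Leray profile system is the steady Navier–Stokes system**: `IsLerayProfile ν 0 U P`
(`−νΔU + 0·U + 0·(y·∇)U + (U·∇)U + ∇P = 0`, `div U = 0`) gives `IsSteadyNSSolution ν 0 U P` —
Wang's system (0.1) `−Δu + u·∇u = −∇p, ∇·u = 0` (with a viscosity), the class both files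
formalise. [cite: Wang2025, (0.1) p. 1] -/
theorem IsLerayProfile.isSteadyNSSolution_zero {E : Type*} [NormedAddCommGroup E]
    [InnerProductSpace ℝ E] [FiniteDimensional ℝ E] {ν : ℝ} {U : E → E} {P : E → ℝ}
    (h : IsLerayProfile ν 0 U P) : IsSteadyNSSolution ν 0 U P where
  contDiff_velocity := h.contDiff_velocity
  contDiff_pressure := h.contDiff_pressure
  momentum y := by
    have e := h.profile_eq y
    simp only [zero_smul, add_zero] at e
    simpa using e
  divFree := h.divFree

/-- **Weak maximum principle for the head pressure of a decaying steady solution**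
(Chae–Weng 2016, Lemma 3.1; Wang 2025, §3.5.1): for `ν > 0`, a classical steady solution
`(U, P)` on `ℝ³` with smooth velocity, `U → 0` and `P → c` at infinity satisfies
`P x + ‖U x‖²/2 ≤ c` for every `x`. [cite: ChaeWeng2016, Lemma 3.1] -/
theorem headPressure_le_of_tendsto {ν : ℝ} (hν : 0 < ν)
    {U : EuclideanSpace ℝ (Fin 3) → EuclideanSpace ℝ (Fin 3)} {P : EuclideanSpace ℝ (Fin 3) → ℝ}
    (h : IsLerayProfile ν 0 U P) (hU : ContDiff ℝ (⊤ : ℕ∞) U)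
    (hUdec : Tendsto U (cocompact (EuclideanSpace ℝ (Fin 3))) (𝓝 0)) {c : ℝ}
    (hPc : Tendsto P (cocompact (EuclideanSpace ℝ (Fin 3))) (𝓝 c)) (x₁ : EuclideanSpace ℝ (Fin 3)) :
    P x₁ + ‖U x₁‖ ^ 2 / 2 ≤ c := by
  -- the head pressure `Hd = ½|U|² + P` (rate `a = 0`)
  set Hd : EuclideanSpace ℝ (Fin 3) → ℝ := headPressure 0 U P with hHd_def
  have hHd_x : ∀ x, Hd x = P x + ‖U x‖ ^ 2 / 2 := fun x => by
    rw [hHd_def, headPressure_apply]; ring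
  have hHd_s : ContDiff ℝ (⊤ : ℕ∞) Hd := h.contDiff_headPressure hU
  have hHd_2 : ContDiff ℝ 2 Hd := hHd_s.of_le (by norm_cast)
  have hHd_c : Continuous Hd := hHd_s.continuous
  have hL_Hd : ∀ y, 0 ≤ driftOp ν 0 U Hd y := fun y => h.driftOp_headPressure_nonneg hU hν.le y
  -- `Hd → c` at infinity
  have hHd_lim : Tendsto Hd (cocompact (EuclideanSpace ℝ (Fin 3))) (𝓝 c) := by
    have h1 : Tendsto (fun x => P x + ‖U x‖ ^ 2 / 2) (cocompact (EuclideanSpace ℝ (Fin 3))) (𝓝 (c + ‖(0 : EuclideanSpace ℝ (Fin 3))‖ ^ 2 / 2)) :=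
      hPc.add ((hUdec.norm.pow 2).div_const 2)
    rw [norm_zero, zero_pow two_ne_zero, zero_div, add_zero] at h1
    exact h1.congr fun x => (hHd_x x).symm
  -- `|U| ≤ M`
  obtain ⟨M, hM0, hM⟩ : ∃ M : ℝ, 0 ≤ M ∧ ∀ y, ‖U y‖ ≤ M := by
    have hev : ∀ᶠ y in cocompact (EuclideanSpace ℝ (Fin 3)), dist (U y) 0 < 1 :=
      Metric.tendsto_nhds.1 hUdec 1 one_pos
    obtain ⟨K, hK, hKsub⟩ := mem_cocompact.1 hev
    obtain ⟨B, hB⟩ := hK.exists_bound_of_continuousOn hU.continuous.continuousOn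
    refine ⟨max B 1, le_max_of_le_right zero_le_one, fun y => ?_⟩
    by_cases hy : y ∈ K
    · exact (hB y hy).trans (le_max_left _ _)
    · have := hKsub hy
      rw [mem_setOf_eq, dist_zero_right] at this
      exact this.le.trans (le_max_right _ _)
  -- it suffices: `Hd x₁ ≤ c + η` for every `η > 0`
  rw [← hHd_x]
  refine le_of_forall_pos_le_add fun η hη => ?_
  -- the radius beyond which `Hd ≤ c + η`
  obtain ⟨R, hR0, hR⟩ : ∃ R : ℝ, 0 < R ∧ ∀ y, R ≤ ‖y - x₁‖ → Hd y ≤ c + η := by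
    have hev : ∀ᶠ y in cocompact (EuclideanSpace ℝ (Fin 3)), dist (Hd y) c < η :=
      Metric.tendsto_nhds.1 hHd_lim η hη
    obtain ⟨K, hK, hKsub⟩ := mem_cocompact.1 hev
    obtain ⟨R₀, hR₀⟩ := hK.isBounded.subset_closedBall x₁
    refine ⟨max R₀ 0 + 1, by positivity, fun y hy => ?_⟩
    have hyK : y ∉ K := fun hyK => by
      have := hR₀ hyK
      rw [mem_closedBall, dist_eq_norm] at this
      linarith [le_max_left R₀ 0]
    have := hKsub hyK
    rw [mem_setOf_eq, Real.dist_eq] at this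
    linarith [(abs_lt.1 this).2]
  -- the strict supersolution `g = exp(k|y − x₁|²)`, `k = M²/(24ν²) + 1`
  set k : ℝ := M ^ 2 / (24 * ν ^ 2) + 1 with hk
  have hk0 : 0 < k := by positivity
  set g : EuclideanSpace ℝ (Fin 3) → ℝ := gaussAt k x₁ with hgdef
  have hg2 : ContDiff ℝ 2 g := contDiff_gaussAt k x₁
  have hLg : ∀ y, 0 < driftOp ν 0 U g y := by
    intro y
    rw [hgdef, driftOp_gaussAt, finrank_euclideanSpace_fin]
    refine mul_pos (gaussAt_pos _ _ _) ?_
    set r : ℝ := ‖y - x₁‖ with hr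
    have hr0 : 0 ≤ r := norm_nonneg _
    have hinner : ⟪y - x₁, U y + (0 : ℝ) • y⟫ ≤ r * M := by
      rw [zero_smul, add_zero]
      exact (real_inner_le_norm _ _).trans (mul_le_mul_of_nonneg_left (hM y) hr0)
    -- `ν(4k²r² + 6k) − 2k r M > 0` since `24 ν² k > M²`
    have hkey : 0 < ν * (4 * k ^ 2 * r ^ 2 + 2 * (3 : ℕ) * k) - 2 * k * (r * M) := by
      have hkM : M ^ 2 < 24 * ν ^ 2 * k := by
        rw [hk]; field_simp; nlinarith [sq_nonneg M, sq_nonneg ν, hν]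
      push_cast
      nlinarith [sq_nonneg (4 * ν * k * r - M), hk0, hν, sq_nonneg r, mul_pos hν hk0]
    have h2k : 0 ≤ 2 * k := by positivity
    nlinarith [mul_le_mul_of_nonneg_left hinner h2k]
  -- the perturbed function `V = Hd + ε(g − 0·g)` and the maximum principle on `B̄(x₁, R)`
  have hstep : ∀ ε : ℝ, 0 < ε → Hd x₁ + ε ≤ c + η + ε * Real.exp (k * R ^ 2) := by
    intro ε hε
    set V : EuclideanSpace ℝ (Fin 3) → ℝ := Hd + ε • (g - (0 : ℝ) • g) with hVdef
    have hVx : ∀ y, V y = Hd y + ε * g y := fun y => by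
      simp [hVdef]
    have hLV : ∀ y, 0 < driftOp ν 0 U V y := fun y => by
      rw [hVdef, driftOp_add_smul_sub ν 0 U hHd_2 hg2 hg2 ε 0 y, zero_mul, sub_zero]
      exact add_pos_of_nonneg_of_pos (hL_Hd y) (mul_pos hε (hLg y))
    have hV2 : ContDiff ℝ 2 V := by
      rw [hVdef]; exact hHd_2.add (contDiff_const.smul (hg2.sub (contDiff_const.smul hg2)))
    have hVc : Continuous V := hV2.continuous
    -- maximum of `V` on the closed ball
    obtain ⟨x₂, hx₂mem, hx₂⟩ := (isCompact_closedBall x₁ R).exists_isMaxOn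
      ⟨x₁, mem_closedBall_self hR0.le⟩ hVc.continuousOn
    -- `x₂` is not in the open ball
    have hx₂R : R ≤ ‖x₂ - x₁‖ := by
      by_contra hlt
      push Not at hlt
      have hball : ball x₁ R ∈ 𝓝 x₂ := isOpen_ball.mem_nhds (by rwa [mem_ball, dist_eq_norm])
      have hloc : IsLocalMax V x₂ := by
        filter_upwards [hball] with y hy
        exact hx₂ (ball_subset_closedBall hy)
      have hle : driftOp ν 0 U V x₂ ≤ 0 := by
        unfold driftOp
        rw [hloc.fderiv_eq_zero, zero_apply, sub_zero]
        exact mul_nonpos_of_nonneg_of_nonpos hν.le (laplacian_nonpos_of_isLocalMax hV2 hloc)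
      exact absurd (hLV x₂) (not_lt.2 hle)
    -- compare `V x₁ ≤ V x₂`
    have h1 : V x₁ ≤ V x₂ := hx₂ (mem_closedBall_self hR0.le)
    have hx₂eq : ‖x₂ - x₁‖ ≤ R := by rwa [mem_closedBall, dist_eq_norm] at hx₂mem
    have hgx₂ : g x₂ ≤ Real.exp (k * R ^ 2) := by
      rw [hgdef, gaussAt]
      exact Real.exp_le_exp.2 (mul_le_mul_of_nonneg_left
        (pow_le_pow_left₀ (norm_nonneg _) hx₂eq 2) hk0.le)
    rw [hVx, hVx, hgdef, gaussAt_self] at h1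
    rw [← hgdef] at h1
    calc Hd x₁ + ε = Hd x₁ + ε * 1 := by ring
      _ ≤ Hd x₂ + ε * g x₂ := h1
      _ ≤ (c + η) + ε * Real.exp (k * R ^ 2) := add_le_add (hR x₂ hx₂R)
          (mul_le_mul_of_nonneg_left hgx₂ hε.le)
  -- `ε → 0`
  have hlim : Tendsto (fun ε : ℝ => c + η + ε * Real.exp (k * R ^ 2) - ε) (𝓝[>] 0)
      (𝓝 (c + η + 0 * Real.exp (k * R ^ 2) - 0)) :=
    ((tendsto_const_nhds.add (tendsto_id.mul tendsto_const_nhds)).sub tendsto_id).mono_left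
      nhdsWithin_le_nhds
  rw [zero_mul, add_zero, sub_zero] at hlim
  refine ge_of_tendsto hlim (eventually_nhdsWithin_of_forall fun ε (hε : 0 < ε) => ?_)
  have := hstep ε hε
  linarith

/-- **The allaxes obligation O1b `HeadMaximumPrinciple`, conditional on Galdi X.5.1**
(named fact `wang2025_thm21_DSolution_uniformDecay`): for every `ν > 0` and every smooth steady
solution with finite Dirichlet integral and `U → 0` at infinity (the hypotheses of
`GaldiLiouvilleGate.GaldiLiouville`, stmt-NavierStokesRegularity-0895), the pressure has a limit
`c` at infinity and `P + |U|²/2 ≤ c` everywhere (`exists_tendsto_pressure_of_tendsto_zero` +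
`headPressure_le_of_tendsto`). [cite: ChaeWeng2016, Lemma 3.1] -/
theorem headMaximumPrinciple_of_uniformDecay (hfact : wang2025_thm21_DSolution_uniformDecay) :
    ∀ ν : ℝ, 0 < ν → ∀ (U : EuclideanSpace ℝ (Fin 3) → EuclideanSpace ℝ (Fin 3))
      (P : EuclideanSpace ℝ (Fin 3) → ℝ),
      (IsLerayProfile ν 0 U P ∧ ContDiff ℝ (⊤ : ℕ∞) U ∧ ContDiff ℝ (⊤ : ℕ∞) P ∧
        (∫⁻ y, ENNReal.ofReal (frobeniusNormSq (fderiv ℝ U y))) < ⊤ ∧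
        Tendsto U (cocompact (EuclideanSpace ℝ (Fin 3))) (𝓝 0)) →
      ∃ c : ℝ, Tendsto P (cocompact (EuclideanSpace ℝ (Fin 3))) (𝓝 c) ∧
        ∀ x, P x + ‖U x‖ ^ 2 / 2 ≤ c := by
  rintro ν hν U P ⟨hprof, hU, -, hD, hdec⟩
  have hDS : IsDSolution ν 0 U P := ⟨hprof.isSteadyNSSolution_zero, hD⟩
  obtain ⟨c, hc⟩ := exists_tendsto_pressure_of_tendsto_zero hfact hν hDS hdec
  exact ⟨c, hc, headPressure_le_of_tendsto hν hprof hU hdec hc⟩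


/-- **O1a of the Liouville-gate cylinder-budget lines, modulo the named fact** (companion of
`headMaximumPrinciple_of_uniformDecay`): GIVEN `wang2025_lem35_DSolution_pressureHessian_integrable`
(W. Wang 2025, Lemma 3.5: `∇²p ∈ L¹(ℝ³)` for `D`-solutions, via CLMS `ℋ¹`–Calderón–Zygmund), every smooth
steady `D`-solution `(U, P)` of the `ν`-system (`ν > 0`) with `U → 0` at infinity has
`∇²P ∈ L¹(ℝ³)` — literally the Prop `PressureHessianIntegrable` of the «all-axes cylinder budget» /
«cylinder budgets» lines for `GaldiLiouvilleGate.GaldiLiouville` (their `IsDSolution ν U P` unfolded),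
by the viscosity normalisation `wang2025_lem35_DSolution_pressureHessian_integrable.of_viscosity`.
[cite: Wang2025, Lemma 3.5] -/
theorem pressureHessianIntegrable_of_fact (hfact : wang2025_lem35_DSolution_pressureHessian_integrable) :
    ∀ ν : ℝ, 0 < ν → ∀ (U : EuclideanSpace ℝ (Fin 3) → EuclideanSpace ℝ (Fin 3))
      (P : EuclideanSpace ℝ (Fin 3) → ℝ),
      (IsLerayProfile ν 0 U P ∧ ContDiff ℝ (⊤ : ℕ∞) U ∧ ContDiff ℝ (⊤ : ℕ∞) P ∧
        (∫⁻ y, ENNReal.ofReal (frobeniusNormSq (fderiv ℝ U y))) < ⊤ ∧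
        Tendsto U (cocompact (EuclideanSpace ℝ (Fin 3))) (𝓝 0)) →
      Integrable (iteratedFDeriv ℝ 2 P) := by
  rintro ν hν U P ⟨hprof, -, hP, hD, hdec⟩
  have hDS : IsDSolution ν 0 U P := ⟨hprof.isSteadyNSSolution_zero, hD⟩
  exact hfact.of_viscosity hν hDS (hP.of_le (by norm_cast)) hdec


/-- **The pressure limit of the Liouville-gate cylinder-budget lines, modulo the named fact**
(companion of `headMaximumPrinciple_of_uniformDecay`, which packages it together with the head
bound): GIVEN `wang2025_thm21_DSolution_uniformDecay` (Galdi 2011 Thm X.5.1 / W. Wang 2025 Thm 2.1),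
every smooth steady `D`-solution `(U, P)` of the `ν`-system (`ν > 0`) with `U → 0` at infinity has a
pressure limit `P → c` at infinity — the hypothesis `(∃ c, P → c)` of the assembled rung
`hoopEnergyLiouville_of_split`, with the lines' `IsDSolution ν U P` bundle unfolded.
[cite: Wang2025, Thm 2.1] -/
theorem pressureLimit_of_uniformDecay (hfact : wang2025_thm21_DSolution_uniformDecay) :
    ∀ ν : ℝ, 0 < ν → ∀ (U : EuclideanSpace ℝ (Fin 3) → EuclideanSpace ℝ (Fin 3))
      (P : EuclideanSpace ℝ (Fin 3) → ℝ),
      (IsLerayProfile ν 0 U P ∧ ContDiff ℝ (⊤ : ℕ∞) U ∧ ContDiff ℝ (⊤ : ℕ∞) P ∧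
        (∫⁻ y, ENNReal.ofReal (frobeniusNormSq (fderiv ℝ U y))) < ⊤ ∧
        Tendsto U (cocompact (EuclideanSpace ℝ (Fin 3))) (𝓝 0)) →
      ∃ c : ℝ, Tendsto P (cocompact (EuclideanSpace ℝ (Fin 3))) (𝓝 c) := by
  rintro ν hν U P ⟨hprof, -, -, hD, hdec⟩
  have hDS : IsDSolution ν 0 U P := ⟨hprof.isSteadyNSSolution_zero, hD⟩
  exact exists_tendsto_pressure_of_tendsto_zero hfact hν hDS hdec

end Literature.Analysis.FluidPDE

end
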